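import Literature.AlgebraicGeometry.Resolution.CartierDivisorControlledTransform
import Literature.AlgebraicGeometry.Resolution.MonomialMarkedIdeals
import Literature.AlgebraicGeometry.Resolution.HypersurfaceRestrictionTransform
import HarnessLib

/-!
# Chain W5.2 — F5J X-side: two lemmas for `StepMixedJR ℓ MixedFormatB`

[OURS · L1 W5.2 · res-D-pv-052 AS stub-7; helper file for `stepMixedJR_mixedFormatB` (`…DepthMixedFormatBStep.lean`).]
NOT a statement of the manuscript under review; fact-free.

* `MixedStep.mem_support_monomialIdeal_iff` — the cosupport of a monomial ideal `Π G^{a_G}` is the union of the members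
  with positive exponent;
* `MixedStep.strictTransformIdeal_eq_controlledTransform_of_not_le` — **the strict transform of an effective Cartier
  divisor `𝓐` along a connected regular centre `Ĉ` lying on an effective Cartier divisor is the controlled transform
  `σᶜ(𝓐, m)` as soon as `𝓐 ≤ Ĉ^m` and `σᶜ(𝓐, m) ≰ Ĉ𝒪`** (then `m` IS the generic order of `𝓐` along `Ĉ`; corollary of
  res-D-pv-026's `IsBlowup.strictTransformIdeal_eq_controlledTransform`, Kollár 3.30.2) — the form in which the X-side of
  the mixed engine knows the host order: `𝓐 ≤ Ĉ^m` from the host cylinder, `σᶜ(𝓐, m) ≰ Ĉ𝒪` restricted from the E-side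
  clause `τᶜ(D, m) ≰ C𝒪` of `IsWeightedSeqJR.cons`.

## References
* J. Kollár, *Lectures on Resolution of Singularities* (2007), 3.30.2, (3.111) Step 3. [Kollar2007]
* E. Bierstone, D. Grigoriev, P. Milman, J. Włodarczyk, arXiv:1206.3090, §3.2 Lemma 3.2.1. [BierstoneGrigorievMilmanWlodarczyk2011]
-/

-- `Summit.<Summit>.<Sub>.Theorems` with `Sub = Summit` (single-conjunct summit, D-0017)
set_option linter.dupNamespace false

noncomputable section

open CategoryTheory CategoryTheory.Limits AlgebraicGeometry TopologicalSpace IsLocalRing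
open Literature.AlgebraicGeometry.Resolution
open Scheme.IdealSheafData

namespace Summit.ResolutionOfSingularities.ResolutionOfSingularities.Theorems

universe u

namespace DepthGraded

namespace MixedStep

/-! ## §1 Two lemmas -/

/-- The cosupport of a monomial ideal: a point lies on `V(Π G^{a_G})` iff it lies on a member with positive exponent. [folklore] -/
theorem mem_support_monomialIdeal_iff {X : Scheme.{u}} (L : List (X.IdealSheafData × ℕ)) (x : X) :
    x ∈ (monomialIdeal L).support ↔ ∃ p ∈ L, 0 < p.2 ∧ x ∈ p.1.support := by
  induction L with
  | nil =>
    simp only [monomialIdeal_nil, Scheme.IdealSheafData.support_top, List.not_mem_nil, false_and, exists_false,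
      iff_false]
    exact id
  | cons p L ih =>
    rw [monomialIdeal_cons]
    have hmul : x ∈ (p.1 ^ p.2 * monomialIdeal L).support ↔ x ∈ (p.1 ^ p.2).support ∨ x ∈ (monomialIdeal L).support := by
      rw [← SetLike.mem_coe, Scheme.IdealSheafData.support_mul, TopologicalSpace.Closeds.coe_sup, Set.mem_union]
      rfl
    rw [hmul, ih]
    constructor
    · rintro (h | ⟨q, hq, hpos, hx⟩)
      · rcases Nat.eq_zero_or_pos p.2 with h0 | hpos
        · rw [h0, pow_zero, Scheme.IdealSheafData.one_eq_top, Scheme.IdealSheafData.support_top] at h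
          exact absurd h id
        · rw [Scheme.IdealSheafData.support_pow _ _ hpos.ne'] at h
          exact ⟨p, List.mem_cons_self, hpos, h⟩
      · exact ⟨q, List.mem_cons_of_mem _ hq, hpos, hx⟩
    · rintro ⟨q, hq, hpos, hx⟩
      rcases List.mem_cons.mp hq with rfl | hq
      · left
        rw [Scheme.IdealSheafData.support_pow _ _ hpos.ne']
        exact hx
      · exact Or.inr ⟨q, hq, hpos, hx⟩

/-- **The strict transform of the carried host IS its controlled transform with the host order** (corollary of
res-D-pv-026's `IsBlowup.strictTransformIdeal_eq_controlledTransform`): `X` regular locally Noetherian with Noetherian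
space, `Ĉ` a regular centre with non-empty connected support contained in an effective Cartier divisor `H` (so nowhere
dense), `𝓐` effective Cartier with `𝓐 ≤ Ĉ^m` and `σᶜ(𝓐, m) ≰ Ĉ𝒪` for a blowing up `σ` along `Ĉ`; then the generic order of `𝓐`
along `Ĉ` is `m`, and `strictTransformIdeal σ Ĉ 𝓐 = σᶜ(𝓐, m)`. [cite: Kollar2007, 3.30.2] [cite: BierstoneGrigorievMilmanWlodarczyk2011, §3.2] -/
theorem strictTransformIdeal_eq_controlledTransform_of_not_le {X X' : Scheme.{u}} [IsLocallyNoetherian X]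
    [NoetherianSpace X] (hX : Scheme.IsRegular X) {Ch H 𝓐 : X.IdealSheafData} (hCh : Scheme.IsRegular Ch.subscheme)
    (hconn : _root_.IsPreconnected (Ch.support : Set X)) (hne : (Ch.support : Set X).Nonempty) (hH : IsEffectiveCartier H)
    (hHC : H ≤ Ch) (h𝓐 : IsEffectiveCartier 𝓐) {m : ℕ} (hle : 𝓐 ≤ Ch ^ m) {σ : X' ⟶ X} (hσ : IsBlowup σ Ch)
    (hnot : ¬ controlledTransform σ Ch 𝓐 m ≤ Ch.comap σ) :
    strictTransformIdeal σ Ch 𝓐 = controlledTransform σ Ch 𝓐 m := by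
  obtain ⟨η, hη⟩ := hCh.exists_isGenericPoint_support_of_isPreconnected hconn hne
  have hηC : η ∈ (Ch.support : Set X) := hη.mem
  have hint : interior (Ch.support : Set X) = ∅ :=
    interior_eq_empty_of_isGenericPoint_of_mem_support hη hH (Scheme.IdealSheafData.support_antitone hHC hηC)
  haveI : IsRegularLocalRing (X.presheaf.stalk η) := hX η
  -- the generic order is at least `m`
  have hlow : (m : ℕ∞) ≤ idealOrder 𝓐 η := by
    rw [le_idealOrder_iff]
    calc stalkIdeal 𝓐 η ≤ stalkIdeal (Ch ^ m) η := stalkIdeal_mono hle η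
      _ = stalkIdeal Ch η ^ m := stalkIdeal_pow _ _ _
      _ ≤ maximalIdeal _ ^ m := Ideal.pow_right_mono ((mem_support_iff_stalkIdeal_le Ch η).mp hηC) m
  -- and not more: otherwise `𝓐 ≤ Ĉ^{m+1}` and `σᶜ(𝓐, m) = Ĉ𝒪 · σᶜ(𝓐, m+1) ≤ Ĉ𝒪`
  have hup : ¬ ((m + 1 : ℕ) : ℕ∞) ≤ idealOrder 𝓐 η := by
    intro hm1
    have h1 : 𝓐 ≤ Ch ^ (m + 1) :=
      le_pow_of_isRegular_subscheme_of_forall_le_idealOrder_of_isRegular hX hCh fun y hy => by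
        haveI : IsRegularLocalRing (X.presheaf.stalk y) := hX y
        exact hm1.trans (idealOrder_le_of_specializes (hη.specializes hy) 𝓐)
    haveI : IsLocallyNoetherian X' := hσ.isLocallyNoetherian
    have hfac := hσ.comap_eq_pow_mul_controlledTransform_of_le_pow hle
    rw [hσ.comap_eq_pow_mul_controlledTransform_of_le_pow h1, pow_succ, mul_assoc] at hfac
    have heq := (hσ.isEffectiveCartier.pow m).eq_of_mul_eq_mul hfac
    apply hnot
    rw [← heq]
    exact mul_le_of_le_one_right' le_top
  have hm : idealOrder 𝓐 η = m := by
    rcases eq_or_lt_of_le hlow with h | h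
    · exact h.symm
    · exfalso
      apply hup
      have h2 := Order.add_one_le_of_lt h
      exact_mod_cast h2
  exact hσ.strictTransformIdeal_eq_controlledTransform hX hCh hη hint hm h𝓐

end MixedStep


end DepthGraded

end Summit.ResolutionOfSingularities.ResolutionOfSingularities.Theorems

end
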